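import Summits.CriticalPhenomena.CardyFormulaZ2.Theorems.CardySusyWardParafermionFamiliesToSLESixAnchorDataLattice
import Summits.CriticalPhenomena.CardyFormulaZ2.Theorems.CardyWhiteToColouredNoiseDiscretisationCells

/-!
# The concrete anchor family (skeleton r4 of line `strip-anchored-vertex-normalisation`,
# crux stmt-CriticalPhenomena-10814), IV: `anchorData` is a discretisation family of the anchor domain

Registered sub-goal `stub_anchorData_isFamily` of the stub `stub_anchorMoment_of_IP`: the concrete Dobrushin
data `anchorData δ` of `…AnchorDefs.lean` satisfy the six `IsFamily` fields on the anchor Dobrushin domain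
`anchorDomain` (diagonal square, free arc `arc 1 = {x + y = 2, |x - y| ≤ 2}`, wired arc `arc 0` = the three
other sides, marks `pt 0 = 2i`, `pt 1 = 2`):

* carrier and mesh by `rfl`;
* `hausdorffEDist (arcA δ) (arc 0) ≤ 4δ` (`hausdorffEDist_arcA_le`): `arc 0 ⊆ arcA δ`, and a point of
  `arcA δ ∖ arc 0` lies on the free side at column `|x - y| > (L - 5/2) δ ≥ 2 - 7δ/2`, within `7δ/2` of a mark;
* `hausdorffEDist (arcB δ) (arc 1) ≤ 4δ` (`hausdorffEDist_arcB_le`): `arcB δ ⊆ arc 1`, and clamping the column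
  of a point of `arc 1` to `[-(L - 5/2) δ, (L - 5/2) δ]` moves it by `≤ 7δ/2`;
* the medial points `δ (L - 3/2, 1)`, `δ (1, L - 3/2)` of the two `A`–`B` edges (`AnchorLattice.zdABEdges_eq`)
  are within `7δ/2` of the marks `2`, `2i` (`hausdorffEDist_marks_le`, with `WhiteToColoured.medialPoint_re_im`);
* eventual admissibility from `AnchorLattice.isZdAdmissible`;
here `0 < δ ≤ 1/4` and `L = ⌈2/δ⌉ - 1` (`L δ < 2 ≤ (L + 1) δ`, `AnchorLattice.exists_level`), and a bound
`≤ ENNReal.ofReal (4δ)` eventually forces the limit `0` (`tendsto_zero_of_le`). All elementary. [folklore]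
-/

noncomputable section

namespace Summit.CriticalPhenomena.CardyFormulaZ2.Theorems.ParafermionFamiliesToSLESix.StripAnchored

open MeasureTheory Filter Set Metric
open scoped Topology BigOperators
open Literature.Probability.LatticeModels
open Literature.Probability.Percolation (bondPercolation half BondConfig)
open Literature.Probability.RandomPlanarGeometry (DobrushinDomain)
open Summit.CriticalPhenomena.CardyFormulaZ2.Theorems.ParafermionPrecompact.Negative (IsFamily VanishesOn)
open S5 (anchorDomain)

namespace AnchorFamily

open scoped ENNReal
open Literature.Probability.RandomPlanarGeometry
open S5 AnchorLattice
open Summit.CriticalPhenomena.CardyFormulaZ2.Theorems.WhiteToColoured (medialPoint_re_im)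

variable {δ : ℝ} {L : ℤ}

/-! ## Generalities: Hausdorff bounds and limits -/

/-- A squeeze: an `ℝ≥0∞`-valued function eventually bounded by `ENNReal.ofReal (c δ)` tends to `0` as
`δ → 0⁺`. [folklore] -/
theorem tendsto_zero_of_le {f : ℝ → ℝ≥0∞} {c : ℝ}
    (h : ∀ᶠ δ in 𝓝[>] (0:ℝ), f δ ≤ ENNReal.ofReal (c * δ)) : Tendsto f (𝓝[>] 0) (𝓝 0) := by
  have h1 : Tendsto (fun δ : ℝ => c * δ) (𝓝 0) (𝓝 0) := by
    simpa using (tendsto_const_nhds (x := c)).mul (Filter.tendsto_id (x := 𝓝 (0:ℝ)))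
  have h2 : Tendsto (fun δ : ℝ => ENNReal.ofReal (c * δ)) (𝓝[>] 0) (𝓝 (ENNReal.ofReal 0)) :=
    ENNReal.tendsto_ofReal (h1.mono_left nhdsWithin_le_nhds)
  rw [ENNReal.ofReal_zero] at h2
  exact tendsto_of_tendsto_of_tendsto_of_le_of_le' tendsto_const_nhds h2
    (Eventually.of_forall fun _ => bot_le) h

/-- Hausdorff distance bound from pointwise real distance bounds. [folklore] -/
theorem hausdorffEDist_le_ofReal {s t : Set ℂ} {r : ℝ} (hr : 0 ≤ r)
    (h1 : ∀ x ∈ s, ∃ y ∈ t, dist x y ≤ r) (h2 : ∀ y ∈ t, ∃ x ∈ s, dist y x ≤ r) :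
    hausdorffEDist s t ≤ ENNReal.ofReal r :=
  hausdorffEDist_le_of_mem_edist
    (fun x hx => by obtain ⟨y, hy, h⟩ := h1 x hx; exact ⟨y, hy, (edist_le_ofReal hr).2 h⟩)
    (fun y hy => by obtain ⟨x, hx, h⟩ := h2 y hy; exact ⟨x, hx, (edist_le_ofReal hr).2 h⟩)

/-- `dist ≤ |Δre| + |Δim|`. [folklore] -/
theorem dist_le_of_re_im {x y : ℂ} {r : ℝ} (h : |x.re - y.re| + |x.im - y.im| ≤ r) : dist x y ≤ r := by
  rw [Complex.dist_eq]
  refine (Complex.norm_le_abs_re_add_abs_im _).trans ?_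
  rwa [Complex.sub_re, Complex.sub_im]

/-! ## The marks and the frontier of the anchor domain -/

/-- The second mark of the anchor domain is `pt 1 = 2`. [folklore] -/
theorem pt_one : anchorDomain.pt 1 = ⟨2, 0⟩ := by
  rw [anchorDomain, MarkedDomain.pt_map]
  change rotHomeo (polygonLoop (rectVerts 1 1) ((![0, 3 / 4] : Fin 2 → ℝ) 1)) = _
  simp only [Matrix.cons_val_one, Matrix.cons_val_fin_one]
  have h := baseLoop_left 0 (by norm_num)
  rw [show ((3:ℝ) + 0) / 4 = 3 / 4 by norm_num] at h
  rw [h, rotHomeo_apply]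
  apply Complex.ext
  · rw [rotC_mul_re]; norm_num
  · rw [rotC_mul_im]; norm_num

/-- The first mark of the anchor domain is `pt 0 = 2i`. [folklore] -/
theorem pt_zero : anchorDomain.pt 0 = ⟨0, 2⟩ := by
  rw [anchorDomain, MarkedDomain.pt_map]
  change rotHomeo (polygonLoop (rectVerts 1 1) ((![0, 3 / 4] : Fin 2 → ℝ) 0)) = _
  simp only [Matrix.cons_val_zero]
  have h := polygonLoop_vertex (l := rectVerts 1 1) (k := 0) (by simp)
  rw [Nat.cast_zero, zero_div] at h
  rw [h, rotHomeo_apply]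
  apply Complex.ext
  · rw [rotC_mul_re]; simp [rectVerts]
  · rw [rotC_mul_im]; simp [rectVerts]; norm_num

/-- Both marks lie on the wired arc `arc 0`. [folklore] -/
theorem marks_mem_arc_zero : (⟨2, 0⟩ : ℂ) ∈ anchorDomain.arc 0 ∧ (⟨0, 2⟩ : ℂ) ∈ anchorDomain.arc 0 := by
  refine ⟨?_, pt_zero ▸ anchorDomain.pt_mem_arc_self 0⟩
  rw [← pt_one]
  simpa using anchorDomain.pt_succ_mem_arc 0

/-- A frontier point of the anchor domain lies on `arc 0` or on `arc 1`. [folklore] -/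
theorem mem_arc_of_mem_frontier {z : ℂ} (hz : z ∈ frontier anchorDomain.carrier) :
    z ∈ anchorDomain.arc 0 ∨ z ∈ anchorDomain.arc 1 := by
  rw [← (anchorDomain.iUnion_arc_holds : ⋃ i, anchorDomain.arc i = frontier anchorDomain.carrier),
    Set.mem_iUnion] at hz
  obtain ⟨i, hi⟩ := hz
  fin_cases i
  · exact Or.inl hi
  · exact Or.inr hi

/-- Real form of the level bounds: `δL < 2 ≤ δL + δ`, so the threshold `T = (L - 5/2) δ` of `arcB`
satisfies `2 - 7δ/2 ≤ T < 2` and `0 ≤ T` (`L ≥ 4`). [folklore] -/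
theorem threshold_bounds (hδ : 0 < δ) (hLδ : (L : ℝ) * δ < 2) (hL1 : 2 ≤ ((L : ℝ) + 1) * δ) (hL : 4 ≤ L) :
    2 - 7 / 2 * δ ≤ ((L : ℝ) - 5 / 2) * δ ∧ ((L : ℝ) - 5 / 2) * δ < 2 ∧ 0 ≤ ((L : ℝ) - 5 / 2) * δ := by
  have hL' : (4 : ℝ) ≤ L := by exact_mod_cast hL
  refine ⟨by nlinarith, by nlinarith, by nlinarith⟩

/-! ## The three Hausdorff bounds -/

/-- **The wired arcs**: `hausdorffEDist (arcA δ) (arc 0) ≤ 4δ`. [folklore] -/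
theorem hausdorffEDist_arcA_le (hδ : 0 < δ) (hLδ : (L : ℝ) * δ < 2) (hL1 : 2 ≤ ((L : ℝ) + 1) * δ)
    (hL : 4 ≤ L) : hausdorffEDist (anchorData δ).arcA (anchorDomain.arc 0) ≤ ENNReal.ofReal (4 * δ) := by
  obtain ⟨hT1, hT2, -⟩ := threshold_bounds hδ hLδ hL1 hL
  refine hausdorffEDist_le_ofReal (by linarith) (fun x hx => ?_) (fun y hy => ?_)
  · obtain ⟨hxf, hxB⟩ := mem_arcA_iff.1 hx
    rcases mem_arc_of_mem_frontier hxf with h0 | h1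
    · exact ⟨x, h0, by rw [dist_self]; linarith⟩
    · obtain ⟨hlev, hcol⟩ := mem_anchorDomain_arc_one.1 h1
      rw [mem_arcB_iff hδ hLδ hL1, not_and] at hxB
      have hcol' := not_le.1 (hxB hlev)
      rw [abs_le] at hcol
      rcases le_or_gt 0 (x.re - x.im) with h | h
      · rw [abs_of_nonneg h] at hcol'
        refine ⟨_, marks_mem_arc_zero.1, dist_le_of_re_im ?_⟩
        rw [abs_of_nonpos (by simp only; linarith), abs_of_nonneg (by simp only; linarith)]
        simp only
        linarith
      · rw [abs_of_neg h] at hcol'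
        refine ⟨_, marks_mem_arc_zero.2, dist_le_of_re_im ?_⟩
        rw [abs_of_nonneg (by simp only; linarith), abs_of_nonpos (by simp only; linarith)]
        simp only
        linarith
  · refine ⟨y, mem_arcA_iff.2 ⟨anchorDomain.arc_subset_frontier 0 hy, fun h => ?_⟩, by rw [dist_self]; linarith⟩
    rw [mem_arcB_iff hδ hLδ hL1] at h
    rcases re_im_of_mem_arc_zero hy with h' | h'
    · linarith [h.1]
    · linarith [h.2]

/-- **The free arcs**: `hausdorffEDist (arcB δ) (arc 1) ≤ 4δ`. [folklore] -/
theorem hausdorffEDist_arcB_le (hδ : 0 < δ) (hLδ : (L : ℝ) * δ < 2) (hL1 : 2 ≤ ((L : ℝ) + 1) * δ)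
    (hL : 4 ≤ L) : hausdorffEDist (anchorData δ).arcB (anchorDomain.arc 1) ≤ ENNReal.ofReal (4 * δ) := by
  obtain ⟨hT1, hT2, hT0⟩ := threshold_bounds hδ hLδ hL1 hL
  set T : ℝ := ((L : ℝ) - 5 / 2) * δ with hT
  refine hausdorffEDist_le_ofReal (by linarith) (fun x hx => ?_) (fun y hy => ?_)
  · rw [mem_arcB_iff hδ hLδ hL1] at hx
    exact ⟨x, mem_anchorDomain_arc_one.2 ⟨hx.1, hx.2.trans hT2.le⟩, by rw [dist_self]; linarith⟩
  · obtain ⟨hlev, hcol⟩ := mem_anchorDomain_arc_one.1 hy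
    rw [abs_le] at hcol
    by_cases hin : |y.re - y.im| ≤ T
    · exact ⟨y, (mem_arcB_iff hδ hLδ hL1).2 ⟨hlev, hin⟩, by rw [dist_self]; linarith⟩
    rcases le_or_gt 0 (y.re - y.im) with h | h
    · rw [abs_of_nonneg h, not_le] at hin
      refine ⟨⟨(2 + T) / 2, (2 - T) / 2⟩, (mem_arcB_iff hδ hLδ hL1).2 ⟨by simp only; ring, ?_⟩,
        dist_le_of_re_im ?_⟩
      · simp only; rw [show (2 + T) / 2 - (2 - T) / 2 = T by ring, abs_of_nonneg hT0]
      · simp only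
        rw [abs_of_nonneg (by linarith), abs_of_nonpos (by linarith)]
        linarith
    · rw [abs_of_neg h, not_le] at hin
      refine ⟨⟨(2 - T) / 2, (2 + T) / 2⟩, (mem_arcB_iff hδ hLδ hL1).2 ⟨by simp only; ring, ?_⟩,
        dist_le_of_re_im ?_⟩
      · simp only; rw [show (2 - T) / 2 - (2 + T) / 2 = -T by ring, abs_neg, abs_of_nonneg hT0]
      · simp only
        rw [abs_of_nonpos (by linarith), abs_of_nonneg (by linarith)]
        linarith

/-- **The marks**: the medial points of the two `A`–`B` edges are within `4δ` of the marks `{2i, 2}`, in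
Hausdorff distance. [folklore] -/
theorem hausdorffEDist_marks_le (hδ : 0 < δ) (hLδ : (L : ℝ) * δ < 2) (hL1 : 2 ≤ ((L : ℝ) + 1) * δ)
    (hL : 4 ≤ L) :
    hausdorffEDist (medialPoint δ '' (anchorData δ).zdABEdges) {anchorDomain.pt 0, anchorDomain.pt 1} ≤
      ENNReal.ofReal (4 * δ) := by
  rw [zdABEdges_eq hδ hLδ hL1 hL, Set.image_pair, pt_zero, pt_one]
  obtain ⟨h1re, h1im⟩ := medialPoint_re_im δ (![L - 2, 1] : Site 2) (![L - 1, 1] : Site 2)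
  obtain ⟨h2re, h2im⟩ := medialPoint_re_im δ (![1, L - 2] : Site 2) (![1, L - 1] : Site 2)
  simp only [Matrix.cons_val_zero, Matrix.cons_val_one, Matrix.cons_val_fin_one] at h1re h1im h2re h2im
  push_cast at h1re h1im h2re h2im
  set m₁ := medialPoint δ s((![L - 2, 1] : Site 2), (![L - 1, 1] : Site 2))
  set m₂ := medialPoint δ s((![1, L - 2] : Site 2), (![1, L - 1] : Site 2))
  have hLδ' : δ * L < 2 := by linarith
  have hL1' : 2 ≤ δ * L + δ := by linarith
  have d₁ : dist m₁ ⟨2, 0⟩ ≤ 4 * δ := by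
    refine dist_le_of_re_im ?_
    rw [h1re, h1im]
    simp only
    rw [abs_of_nonpos (by nlinarith), abs_of_nonneg (by linarith)]
    nlinarith
  have d₂ : dist m₂ ⟨0, 2⟩ ≤ 4 * δ := by
    refine dist_le_of_re_im ?_
    rw [h2re, h2im]
    simp only
    rw [abs_of_nonneg (by linarith), abs_of_nonpos (by nlinarith)]
    nlinarith
  refine hausdorffEDist_le_ofReal (by linarith) (fun x hx => ?_) (fun y hy => ?_)
  · rcases hx with rfl | rfl
    · exact ⟨_, Or.inr rfl, d₁⟩
    · exact ⟨_, Or.inl rfl, d₂⟩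
  · rcases hy with rfl | rfl
    · exact ⟨_, Or.inr rfl, by rw [dist_comm]; exact d₂⟩
    · exact ⟨_, Or.inl rfl, by rw [dist_comm]; exact d₁⟩

/-- The three Hausdorff bounds and admissibility, eventually in the mesh. [folklore] -/
theorem eventually_bounds : ∀ᶠ δ in 𝓝[>] (0:ℝ),
    hausdorffEDist (anchorData δ).arcA (anchorDomain.arc 0) ≤ ENNReal.ofReal (4 * δ) ∧
    hausdorffEDist (anchorData δ).arcB (anchorDomain.arc 1) ≤ ENNReal.ofReal (4 * δ) ∧
    hausdorffEDist (medialPoint δ '' (anchorData δ).zdABEdges) {anchorDomain.pt 0, anchorDomain.pt 1} ≤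
      ENNReal.ofReal (4 * δ) ∧ (anchorData δ).IsZdAdmissible := by
  filter_upwards [Ioc_mem_nhdsGT (show (0:ℝ) < 1 / 4 by norm_num)] with δ hδ
  obtain ⟨L, hL7, hLδ, hL1⟩ := exists_level hδ.1 hδ.2
  have hL : 4 ≤ L := by omega
  exact ⟨hausdorffEDist_arcA_le hδ.1 hLδ hL1 hL, hausdorffEDist_arcB_le hδ.1 hLδ hL1 hL,
    hausdorffEDist_marks_le hδ.1 hLδ hL1 hL, isZdAdmissible hδ.1 hLδ hL1 hL⟩

end AnchorFamily

open AnchorFamily in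
/-- **Registered one-line form `stub_anchorData_isFamily`** (sub-goal of `stub_anchorMoment_of_IP`, line
`strip-anchored-vertex-normalisation`, skeleton r4): the concrete anchor data form a discretisation family
of the anchor Dobrushin domain (the six `IsFamily` fields: carrier, mesh, arcs and marks in Hausdorff
distance `≤ 4δ → 0`, eventual admissibility). [folklore] -/
theorem stub_anchorData_isFamily : IsFamily anchorDomain anchorData := by
  refine ⟨fun _ => rfl, fun _ => rfl, tendsto_zero_of_le (c := 4) ?_, tendsto_zero_of_le (c := 4) ?_,
    tendsto_zero_of_le (c := 4) ?_, ?_⟩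
  · exact eventually_bounds.mono fun δ h => h.1
  · exact eventually_bounds.mono fun δ h => h.2.1
  · exact eventually_bounds.mono fun δ h => h.2.2.1
  · exact eventually_bounds.mono fun δ h => h.2.2.2

end Summit.CriticalPhenomena.CardyFormulaZ2.Theorems.ParafermionFamiliesToSLESix.StripAnchored

end
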